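import Literature.Topology.FourManifolds.GroupTrisections
import Summits.SmoothPoincare4.SmoothPoincare4.Theorems.WaldhausenPairs.Negative.StandardPairSymmetries
import HarnessLib

/-!
# `ShadowsStandard` / line power-twist-absorption — stub `stub_goeritzS1`

The Goeritz element `S₁` of the standard genus-3 Heegaard pair `(N₀, N₁)` of `S₃ = π₁(Σ₃)`:
the automorphism
`S₁ : a₁ ↦ a₁, b₁ ↦ b₂⁻¹a₁b₁, a₂ ↦ b₂⁻¹a₁a₂b₂, b₂ ↦ b₂, a₃ ↦ a₁b₂⁻¹a₃b₂a₁⁻¹, b₃ ↦ a₁b₂⁻¹b₃b₂a₁⁻¹`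
(it sends the relator `r = [a₁,b₁][a₂,b₂][a₃,b₃]` to `(a₁b₂⁻¹) r (a₁b₂⁻¹)⁻¹`; its inverse
`a₁ ↦ a₁, b₁ ↦ a₁⁻¹b₂b₁, a₂ ↦ a₁⁻¹b₂a₂b₂⁻¹, b₂ ↦ b₂, a₃ ↦ b₂a₁⁻¹a₃a₁b₂⁻¹, b₃ ↦ b₂a₁⁻¹b₃a₁b₂⁻¹`
sends `r` to `(b₂a₁⁻¹) r (b₂a₁⁻¹)⁻¹`) stabilises `N₀ = ⟪a₁,a₂,b₃⟫` and `N₁ = ⟪a₁,b₂,a₃⟫`.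
Def-free: the two endomorphisms are built inside the proof from their generator images
(`presentedLift`), shown mutually inverse on generators (`PresentedGroup.ext`), and the kernel
images are controlled generator by generator (each image is a product of conjugates of kernel
generators). Lean indices: `a i = SurfaceGroup.a i = aᵢ₊₁`, `b i = SurfaceGroup.b i = bᵢ₊₁`.
-/

-- the prescribed namespace `Summit.<P>.<Sub>.…` duplicates `SmoothPoincare4` (P = Sub)
set_option linter.dupNamespace false

noncomputable section

namespace Summit.SmoothPoincare4.SmoothPoincare4.Theorems.ShadowsStandard.PowerTwistAbsorption

open Literature.Topology.FourManifolds Subgroup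

/-- The genus-3 surface relator, expanded: `r = [a₁,b₁]([a₂,b₂][a₃,b₃])`. [folklore] -/
private theorem goeritzS1_surfaceRelator_three :
    surfaceRelator 3 = genA 0 * genB 0 * (genA 0)⁻¹ * (genB 0)⁻¹ *
      (genA 1 * genB 1 * (genA 1)⁻¹ * (genB 1)⁻¹ *
      (genA 2 * genB 2 * (genA 2)⁻¹ * (genB 2)⁻¹)) := by
  simp [surfaceRelator, List.finRange_succ]

/-- An endomorphism sending each element of `S` into the normal closure of `S` maps that normal
closure into itself. [folklore] -/
private theorem goeritzS1_map_normalClosure_le {G : Type*} [Group G] (f : G →* G) (S : Set G)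
    (h : ∀ s ∈ S, f s ∈ normalClosure S) : (normalClosure S).map f ≤ normalClosure S :=
  map_le_iff_le_comap.2 (normalClosure_le_normal fun s hs => h s hs)

/-- If an automorphism and its inverse both map `N` into `N`, then the image of `N` is `N`.
[folklore] -/
private theorem goeritzS1_map_equiv_eq {G : Type*} [Group G] (e : G ≃* G) (N : Subgroup G)
    (h₁ : N.map e.toMonoidHom ≤ N) (h₂ : N.map e.symm.toMonoidHom ≤ N) :
    N.map e.toMonoidHom = N :=
  le_antisymm h₁ fun x hx =>
    mem_map.2 ⟨e.symm x, h₂ (mem_map_of_mem e.symm.toMonoidHom hx), e.apply_symm_apply x⟩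

/-- A generator map on the free group sending the surface relator to a conjugate of itself
kills the relator in `S₃` (so it descends to an endomorphism of `S₃`). [folklore] -/
private theorem goeritzS1_kills_surfaceRelator (E : surfaceGen 3 → FreeGroup (surfaceGen 3))
    (u : FreeGroup (surfaceGen 3))
    (hE : FreeGroup.lift E (surfaceRelator 3) = u * surfaceRelator 3 * u⁻¹) :
    ∀ r ∈ ({surfaceRelator 3} : Set (FreeGroup (surfaceGen 3))),
      ((PresentedGroup.mk _ : FreeGroup (surfaceGen 3) →* SurfaceGroup 3).comp
        (FreeGroup.lift E)) r = 1 := by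
  intro r hr
  rw [Set.mem_singleton_iff] at hr
  subst hr
  rw [MonoidHom.comp_apply, hE, map_mul, map_mul, map_inv,
    PresentedGroup.one_of_mem (Set.mem_singleton _), mul_one, mul_inv_cancel]

/-- **`stub_goeritzS1`** (Goeritz generator `S₁`, genus 3): there is an automorphism of `S₃`
with the generator images of `S₁` (`a₁, b₂` fixed, `b₁ ↦ b₂⁻¹a₁b₁`, `a₂ ↦ b₂⁻¹a₁a₂b₂`,
`a₃ ↦ a₁b₂⁻¹a₃b₂a₁⁻¹`, `b₃ ↦ a₁b₂⁻¹b₃b₂a₁⁻¹`) stabilising the standard Heegaard pair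
`N₀ = s4Kernels 0`, `N₁ = s4Kernels 1`. [folklore] -/
theorem stub_goeritzS1 :
    ∃ χ : SurfaceGroup 3 ≃* SurfaceGroup 3,
      χ (SurfaceGroup.a 0) = SurfaceGroup.a 0 ∧
      χ (SurfaceGroup.b 0) = (SurfaceGroup.b 1)⁻¹ * SurfaceGroup.a 0 * SurfaceGroup.b 0 ∧
      χ (SurfaceGroup.a 1) = (SurfaceGroup.b 1)⁻¹ * SurfaceGroup.a 0 * SurfaceGroup.a 1 * SurfaceGroup.b 1 ∧
      χ (SurfaceGroup.b 1) = SurfaceGroup.b 1 ∧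
      χ (SurfaceGroup.a 2) = SurfaceGroup.a 0 * (SurfaceGroup.b 1)⁻¹ * SurfaceGroup.a 2 * SurfaceGroup.b 1 *
        (SurfaceGroup.a 0)⁻¹ ∧
      χ (SurfaceGroup.b 2) = SurfaceGroup.a 0 * (SurfaceGroup.b 1)⁻¹ * SurfaceGroup.b 2 * SurfaceGroup.b 1 *
        (SurfaceGroup.a 0)⁻¹ ∧
      (s4Kernels 0).map χ.toMonoidHom = s4Kernels 0 ∧ (s4Kernels 1).map χ.toMonoidHom = s4Kernels 1 := by
  -- generator images of `S₁` on the free group `F⟨a₁,b₁,a₂,b₂,a₃,b₃⟩`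
  let F : surfaceGen 3 → FreeGroup (surfaceGen 3) := fun x =>
    if x = (0, true) then
      (FreeGroup.of (1, true))⁻¹ * FreeGroup.of (0, false) * FreeGroup.of (0, true)
    else if x = (1, false) then
      (FreeGroup.of (1, true))⁻¹ * FreeGroup.of (0, false) * FreeGroup.of (1, false) *
        FreeGroup.of (1, true)
    else if x = (2, false) then
      FreeGroup.of (0, false) * (FreeGroup.of (1, true))⁻¹ * FreeGroup.of (2, false) *
        FreeGroup.of (1, true) * (FreeGroup.of (0, false))⁻¹
    else if x = (2, true) then
      FreeGroup.of (0, false) * (FreeGroup.of (1, true))⁻¹ * FreeGroup.of (2, true) *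
        FreeGroup.of (1, true) * (FreeGroup.of (0, false))⁻¹
    else FreeGroup.of x
  -- generator images of `S₁⁻¹`
  let G : surfaceGen 3 → FreeGroup (surfaceGen 3) := fun x =>
    if x = (0, true) then
      (FreeGroup.of (0, false))⁻¹ * FreeGroup.of (1, true) * FreeGroup.of (0, true)
    else if x = (1, false) then
      (FreeGroup.of (0, false))⁻¹ * FreeGroup.of (1, true) * FreeGroup.of (1, false) *
        (FreeGroup.of (1, true))⁻¹
    else if x = (2, false) then
      FreeGroup.of (1, true) * (FreeGroup.of (0, false))⁻¹ * FreeGroup.of (2, false) *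
        FreeGroup.of (0, false) * (FreeGroup.of (1, true))⁻¹
    else if x = (2, true) then
      FreeGroup.of (1, true) * (FreeGroup.of (0, false))⁻¹ * FreeGroup.of (2, true) *
        FreeGroup.of (0, false) * (FreeGroup.of (1, true))⁻¹
    else FreeGroup.of x
  -- `S₁ r = (a₁b₂⁻¹) r (a₁b₂⁻¹)⁻¹` and `S₁⁻¹ r = (b₂a₁⁻¹) r (b₂a₁⁻¹)⁻¹` in the free group
  have hF : FreeGroup.lift F (surfaceRelator 3) =
      genA 0 * (genB 1)⁻¹ * surfaceRelator 3 * (genA 0 * (genB 1)⁻¹)⁻¹ := by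
    simp only [goeritzS1_surfaceRelator_three, F, map_mul, map_inv, FreeGroup.lift_apply_of, genA,
      genB]
    simp
    group
  have hG : FreeGroup.lift G (surfaceRelator 3) =
      genB 1 * (genA 0)⁻¹ * surfaceRelator 3 * (genB 1 * (genA 0)⁻¹)⁻¹ := by
    simp only [goeritzS1_surfaceRelator_three, G, map_mul, map_inv, FreeGroup.lift_apply_of, genA,
      genB]
    simp
    group
  -- the automorphism, remembered only through its action (and its inverse's) on words
  obtain ⟨χ, hχ, hχ'⟩ : ∃ χ : SurfaceGroup 3 ≃* SurfaceGroup 3,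
      (∀ w, χ (PresentedGroup.mk _ w) = PresentedGroup.mk _ (FreeGroup.lift F w)) ∧
      (∀ w, χ.symm (PresentedGroup.mk _ w) = PresentedGroup.mk _ (FreeGroup.lift G w)) := by
    let φ : SurfaceGroup 3 →* SurfaceGroup 3 :=
      presentedLift ((PresentedGroup.mk _).comp (FreeGroup.lift F))
        (goeritzS1_kills_surfaceRelator F _ hF)
    let ψ : SurfaceGroup 3 →* SurfaceGroup 3 :=
      presentedLift ((PresentedGroup.mk _).comp (FreeGroup.lift G))
        (goeritzS1_kills_surfaceRelator G _ hG)
    have hφ : ∀ w, φ (PresentedGroup.mk _ w) = PresentedGroup.mk _ (FreeGroup.lift F w) :=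
      fun w => presentedLift_mk _ _ w
    have hψ : ∀ w, ψ (PresentedGroup.mk _ w) = PresentedGroup.mk _ (FreeGroup.lift G w) :=
      fun w => presentedLift_mk _ _ w
    refine ⟨MonoidHom.toMulEquiv φ ψ ?_ ?_, hφ, hψ⟩
    · refine PresentedGroup.ext fun x => ?_
      obtain ⟨k, c⟩ := x
      fin_cases k <;> cases c <;> simp [PresentedGroup.of, hφ, hψ, F, G, mul_assoc]
    · refine PresentedGroup.ext fun x => ?_
      obtain ⟨k, c⟩ := x
      fin_cases k <;> cases c <;> simp [PresentedGroup.of, hφ, hψ, F, G, mul_assoc]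
  -- generator values of `χ = S₁` and of `χ⁻¹`
  have va0 : χ (SurfaceGroup.a 0) = SurfaceGroup.a 0 := by
    simp [SurfaceGroup.a, PresentedGroup.of, hχ, F]
  have vb0 : χ (SurfaceGroup.b 0) = (SurfaceGroup.b 1)⁻¹ * SurfaceGroup.a 0 * SurfaceGroup.b 0 := by
    simp [SurfaceGroup.a, SurfaceGroup.b, PresentedGroup.of, hχ, F, mul_assoc]
  have va1 : χ (SurfaceGroup.a 1) =
      (SurfaceGroup.b 1)⁻¹ * SurfaceGroup.a 0 * SurfaceGroup.a 1 * SurfaceGroup.b 1 := by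
    simp [SurfaceGroup.a, SurfaceGroup.b, PresentedGroup.of, hχ, F, mul_assoc]
  have vb1 : χ (SurfaceGroup.b 1) = SurfaceGroup.b 1 := by
    simp [SurfaceGroup.b, PresentedGroup.of, hχ, F]
  have va2 : χ (SurfaceGroup.a 2) = SurfaceGroup.a 0 * (SurfaceGroup.b 1)⁻¹ * SurfaceGroup.a 2 *
      SurfaceGroup.b 1 * (SurfaceGroup.a 0)⁻¹ := by
    simp [SurfaceGroup.a, SurfaceGroup.b, PresentedGroup.of, hχ, F, mul_assoc]
  have vb2 : χ (SurfaceGroup.b 2) = SurfaceGroup.a 0 * (SurfaceGroup.b 1)⁻¹ * SurfaceGroup.b 2 *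
      SurfaceGroup.b 1 * (SurfaceGroup.a 0)⁻¹ := by
    simp [SurfaceGroup.a, SurfaceGroup.b, PresentedGroup.of, hχ, F, mul_assoc]
  have wa0 : χ.symm (SurfaceGroup.a 0) = SurfaceGroup.a 0 := by
    simp [SurfaceGroup.a, PresentedGroup.of, hχ', G]
  have wa1 : χ.symm (SurfaceGroup.a 1) =
      (SurfaceGroup.a 0)⁻¹ * SurfaceGroup.b 1 * SurfaceGroup.a 1 * (SurfaceGroup.b 1)⁻¹ := by
    simp [SurfaceGroup.a, SurfaceGroup.b, PresentedGroup.of, hχ', G, mul_assoc]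
  have wb1 : χ.symm (SurfaceGroup.b 1) = SurfaceGroup.b 1 := by
    simp [SurfaceGroup.b, PresentedGroup.of, hχ', G]
  have wa2 : χ.symm (SurfaceGroup.a 2) = SurfaceGroup.b 1 * (SurfaceGroup.a 0)⁻¹ * SurfaceGroup.a 2 *
      SurfaceGroup.a 0 * (SurfaceGroup.b 1)⁻¹ := by
    simp [SurfaceGroup.a, SurfaceGroup.b, PresentedGroup.of, hχ', G, mul_assoc]
  have wb2 : χ.symm (SurfaceGroup.b 2) = SurfaceGroup.b 1 * (SurfaceGroup.a 0)⁻¹ * SurfaceGroup.b 2 *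
      SurfaceGroup.a 0 * (SurfaceGroup.b 1)⁻¹ := by
    simp [SurfaceGroup.a, SurfaceGroup.b, PresentedGroup.of, hχ', G, mul_assoc]
  -- kernel images: `χ^{±1} N₀ ≤ N₀`, `χ^{±1} N₁ ≤ N₁`, generator by generator
  have hN0 : s4Kernels 0 = normalClosure {SurfaceGroup.a 0, SurfaceGroup.a 1, SurfaceGroup.b 2} := rfl
  have hN1 : s4Kernels 1 = normalClosure {SurfaceGroup.a 0, SurfaceGroup.b 1, SurfaceGroup.a 2} := rfl
  have k0 : (s4Kernels 0).map χ.toMonoidHom = s4Kernels 0 := by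
    rw [hN0]
    have nN : (normalClosure ({SurfaceGroup.a 0, SurfaceGroup.a 1, SurfaceGroup.b 2} :
      Set (SurfaceGroup 3))).Normal := normalClosure_normal
    have ha0 : SurfaceGroup.a 0 ∈ normalClosure ({SurfaceGroup.a 0, SurfaceGroup.a 1, SurfaceGroup.b 2} :
      Set (SurfaceGroup 3)) := subset_normalClosure (by simp)
    have ha1 : SurfaceGroup.a 1 ∈ normalClosure ({SurfaceGroup.a 0, SurfaceGroup.a 1, SurfaceGroup.b 2} :
      Set (SurfaceGroup 3)) := subset_normalClosure (by simp)
    have hb2 : SurfaceGroup.b 2 ∈ normalClosure ({SurfaceGroup.a 0, SurfaceGroup.a 1, SurfaceGroup.b 2} :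
      Set (SurfaceGroup 3)) := subset_normalClosure (by simp)
    refine goeritzS1_map_equiv_eq χ _ (goeritzS1_map_normalClosure_le _ _ ?_)
      (goeritzS1_map_normalClosure_le _ _ ?_)
    · rintro s (rfl | rfl | rfl)
      · rw [MulEquiv.coe_toMonoidHom, va0]
        exact ha0
      · rw [MulEquiv.coe_toMonoidHom, va1]
        simpa only [mul_assoc] using nN.conj_mem' _ (mul_mem ha0 ha1) (SurfaceGroup.b 1)
      · rw [MulEquiv.coe_toMonoidHom, vb2]
        simpa only [mul_assoc] using
          mul_mem (mul_mem ha0 (nN.conj_mem' _ hb2 (SurfaceGroup.b 1))) (inv_mem ha0)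
    · rintro s (rfl | rfl | rfl)
      · rw [MulEquiv.coe_toMonoidHom, wa0]
        exact ha0
      · rw [MulEquiv.coe_toMonoidHom, wa1]
        simpa only [mul_assoc] using mul_mem (inv_mem ha0) (nN.conj_mem _ ha1 (SurfaceGroup.b 1))
      · rw [MulEquiv.coe_toMonoidHom, wb2]
        simpa only [mul_assoc] using
          nN.conj_mem _ (nN.conj_mem' _ hb2 (SurfaceGroup.a 0)) (SurfaceGroup.b 1)
  have k1 : (s4Kernels 1).map χ.toMonoidHom = s4Kernels 1 := by
    rw [hN1]
    have ha0 : SurfaceGroup.a 0 ∈ normalClosure ({SurfaceGroup.a 0, SurfaceGroup.b 1, SurfaceGroup.a 2} :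
      Set (SurfaceGroup 3)) := subset_normalClosure (by simp)
    have hb1 : SurfaceGroup.b 1 ∈ normalClosure ({SurfaceGroup.a 0, SurfaceGroup.b 1, SurfaceGroup.a 2} :
      Set (SurfaceGroup 3)) := subset_normalClosure (by simp)
    have ha2 : SurfaceGroup.a 2 ∈ normalClosure ({SurfaceGroup.a 0, SurfaceGroup.b 1, SurfaceGroup.a 2} :
      Set (SurfaceGroup 3)) := subset_normalClosure (by simp)
    refine goeritzS1_map_equiv_eq χ _ (goeritzS1_map_normalClosure_le _ _ ?_)
      (goeritzS1_map_normalClosure_le _ _ ?_)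
    · rintro s (rfl | rfl | rfl)
      · rw [MulEquiv.coe_toMonoidHom, va0]
        exact ha0
      · rw [MulEquiv.coe_toMonoidHom, vb1]
        exact hb1
      · rw [MulEquiv.coe_toMonoidHom, va2]
        exact mul_mem (mul_mem (mul_mem (mul_mem ha0 (inv_mem hb1)) ha2) hb1) (inv_mem ha0)
    · rintro s (rfl | rfl | rfl)
      · rw [MulEquiv.coe_toMonoidHom, wa0]
        exact ha0
      · rw [MulEquiv.coe_toMonoidHom, wb1]
        exact hb1
      · rw [MulEquiv.coe_toMonoidHom, wa2]
        exact mul_mem (mul_mem (mul_mem (mul_mem hb1 (inv_mem ha0)) ha2) ha0) (inv_mem hb1)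
  exact ⟨χ, va0, vb0, va1, vb1, va2, vb2, k0, k1⟩

end Summit.SmoothPoincare4.SmoothPoincare4.Theorems.ShadowsStandard.PowerTwistAbsorption

end
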